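import Summits.ResolutionOfSingularities.ResolutionOfSingularities.Theorems.HilbertSamuelEliminationSigmaMaxModificationsCorridor3WLadderSegmentsTowerEndsU
import Summits.ResolutionOfSingularities.ResolutionOfSingularities.Theorems.HilbertSamuelEliminationSigmaMaxModificationsCorridor3WLadderSegmentsExtractFree
import Summits.ResolutionOfSingularities.ResolutionOfSingularities.Theorems.HilbertSamuelEliminationSigmaMaxModificationsCorridor3WLadderSegmentsHEmp
import HarnessLib

/-!
# [OURS · L1 W4.2] THE UNITS-HALF EXTRACTION, REPAIRED: with the unit tower `Seg.unitTowerU` (compression inside the unit only) and the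
# recognition hypothesis (H-emp) restricted to the unit (`Seg.HEmpU`) — `Seg.UnitRecognitionAtQMU` and `Moving.unitTowerExtractionLocQM_of_recognitionU`
# (crux `SigmaMaxModifications` stmt-ResolutionOfSingularities-18506; conjunct `SigmaMaxModificationsCorridor3` stmt-…-19249; line `w_ladder`; U-seg repair)

Stub worker res-L1-w42-stub-1 (gen 4). Helper file `--supports stmt-ResolutionOfSingularities-19249 --as helper`; kernel only, no named fact.

The statements of `…SegmentsExtract` / `…SegmentsExtractFree` (gen 3) re-derived VERBATIM for the repaired unit tower. The ONLY change is the
recognition hypothesis: `Seg.UnitRecognitionAtQMU p Q` asks, at every blown-up isolated stage `b`, for **(H-emp) WITHIN THE UNIT** (`Seg.HEmpU`,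
proved in `…SegmentsHEmp` from the geometric inputs (Dich)/(RegN)) and the centre discipline of `Seg.unitTowerU b` (CJS Def. 6.38 (ii)′ (iii) (iv)
(v)); the gen-3 `Seg.UnitRecognitionAtQM` asked for `Seg.HEmp` at ALL later stages, which fails beyond the unit (sibling near points desynchronise).
Conclusions unchanged: `UnitTowerExtractionLocQM p` / the characteristic-free form / `UnitTowerExtractionLocAtQM p Q`.

* `Seg.isFundamentalUnit_unitTowerU`, `Seg.exists_localizedChainU`, `Seg.exists_localizedChainU_free`, `Seg.UnitRecognitionAtQMU`,
  **`Moving.unitTowerExtractionLocQM_of_recognitionU : Seg.UnitRecognitionAtQMU p (QCharRegime p) → UnitTowerExtractionLocQM p`**,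
  `Moving.unitTowerExtractionLocFree_of_recognitionU`, `Moving.unitTowerExtractionLocAtQM_of_recognitionU`.

OURS bookkeeping; NOT a statement of the manuscript [Hironaka2017] nor of [CossartJannsenSaito2020]. AI-written; AI review is weaker than expert
review.

References: V. Cossart, U. Jannsen, S. Saito, LNM 2270 (2020), Def. 6.38, Def. 6.39, Thm. 6.40, p. 107 [CossartJannsenSaito2020].
-/

noncomputable section

set_option linter.dupNamespace false -- namespace `…Corridor3.Moving` re-enters `…Corridor3` (module convention of the Moving files)

open CategoryTheory AlgebraicGeometry TopologicalSpace Topology IsLocalRing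
open Literature.AlgebraicGeometry.Resolution Literature.RingTheory.HilbertSamuel
open Literature.AlgebraicGeometry.CossartJannsenSaito2020
open Summit.ResolutionOfSingularities.ResolutionOfSingularities.Theorems.CampaignW42
open Summit.ResolutionOfSingularities.ResolutionOfSingularities.Theorems.SigmaMaxModificationsCorridor3.Helpers

namespace Summit.ResolutionOfSingularities.ResolutionOfSingularities.Theorems.SigmaMaxModificationsCorridor3.Moving

namespace Seg

universe u

/-! ## §1. The centre discipline and the fundamental unit -/

section Extraction

variable {R : ∀ S : Scheme.{0}, CentreSeq S → Prop} {N : ℕ} {ν : ℕ → ℕ} {k : Type} [Field k]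
  {c : ℕ → MarkedStage.{0}} (hc : ∀ n, CanonicalNearStep R N ν (c n) (c (n + 1))) (hRf : OracleFunctional R) (hRa : OracleAdmissible R)
  (hν : ν ≠ iterPSum N Phi) (h0 : Helpers.CycleInv k N ν (c 0)) (hgen : ∀ n, ∃ m, n ≤ m ∧ (c m).IsBlownUp R N ν)
  (hBG : ∀ n, ∃ m, n ≤ m ∧ (c m).IsBlownUp R N ν ∧ Iso N (c m))
  {p : ℕ} {X : Scheme.{0}} [IsLocallyNoetherian X] {x : X} (hX : IsMaximalOrigin p N ν X x)
  (hreach : Reaches R N ν (MarkedStage.init X x) (c 0)) (h22 : ∀ n, Iso N (c n) → dirDim (c n) = 2 ∧ (c n).geomDirDim = 2)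

include hRf hX hreach h22 in
/-- **THE UNIT TOWER AT A BLOWN-UP ISOLATED STAGE IS A FUNDAMENTAL UNIT, given the centre discipline** (CJS Def. 6.38): all other clauses are
discharged. [cite: CossartJannsenSaito2020, Def. 6.38, p. 107] -/
theorem isFundamentalUnit_unitTowerU (b : ℕ) (hb : (c b).IsBlownUp R N ν) (hiso : Iso N (c b)) (hemp : HEmpU hc hRa hν h0 hgen hBG b)
    (hdisc : UnitCentreDiscipline (unitTowerU hc hRa hν h0 hgen hBG b hemp) N (unitLen hgen hBG b) (basePt hc hRa hν h0 b)) :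
    IsFundamentalUnit (unitTowerU hc hRa hν h0 hgen hBG b hemp) N (unitLen hgen hBG b) (basePt hc hRa hν h0 b)
      (termPtU hc hRa hν h0 hgen hBG b hemp) where
  one_le_length := one_le_unitLen hgen hBG b
  isClosed_point := isClosed_basePtU hc hRa hν h0 hgen hBG b hemp
  dirDim_eq := (dirDimAt_unitTowerU_zero hc hRa hν h0 hgen hBG b hemp).trans (h22 b hiso).1
  geomDirDim_eq := (geomDirDimAt_unitTowerU_zero hc hRa hν h0 hgen hBG b hemp).trans (h22 b hiso).2
  centre_zero := unitTowerU_C_zero hc hRa hν h0 hgen hBG hRf hX b hemp (reaches_chain hreach hc b) hb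
    (stratumIsolated_at hc hRa hν hX hreach b hiso)
  centre_one := hdisc.1
  centre_near := hdisc.2.1
  permissible q _ := isPermissible_centreIdeal_unitTowerU hc hRa hν h0 hgen hBG b hemp q
  iso := hdisc.2.2.1
  not_surjective := hdisc.2.2.2
  isClosed_terminal := isClosed_termPtU hc hRa hν h0 hgen hBG hX.isClosed b hemp (reaches_chain hreach hc _)
  terminal_over := phi_termPtU hc hRa hν h0 hgen hBG b hemp
  terminal_near := by
    rw [hsFun_unitTowerU_terminal, hsFun_unitTowerU_zero, hsFun_pt hc hX hreach, hsFun_pt hc hX hreach]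
  terminal_dirDim := (dirDimAt_unitTowerU_terminal hc hRa hν h0 hgen hBG b hemp).trans (h22 _ (Seg.G_nextBaseU hgen hBG b)).1
  terminal_geomDirDim :=
    (geomDirDimAt_unitTowerU_terminal hc hRa hν h0 hgen hBG b hemp).trans (h22 _ (Seg.G_nextBaseU hgen hBG b)).2

/-! ## §2. The extraction -/

include hRf hX hreach h22 in
/-- **THE UNITS-HALF EXTRACTION.** Given (H-emp) and the centre discipline at every blown-up isolated stage, and (F1) along the chain, the unit
towers at the bases `segBase 0 < segBase 1 < ⋯` form a unit-wise localised chain of fundamental units with the setting, (F1) and isolation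
at every initial point. [cite: CossartJannsenSaito2020, Def. 6.38, Def. 6.39, Thm. 6.40, p. 107] -/
theorem exists_localizedChainU
    (hemp : ∀ b, (c b).IsBlownUp R N ν → Iso N (c b) → HEmpU hc hRa hν h0 hgen hBG b)
    (hdisc : ∀ b (hb : (c b).IsBlownUp R N ν) (hiso : Iso N (c b)),
      UnitCentreDiscipline (unitTowerU hc hRa hν h0 hgen hBG b (hemp b hb hiso)) N (unitLen hgen hBG b) (basePt hc hRa hν h0 b))
    (hchar : ∀ n, CharHypothesis (c n).W (c n).pt) :
    ∃ (T : ℕ → BlowupTower.{0}) (len : ℕ → ℕ) (pt : ∀ i, (T i).X 0) (tpt : ∀ i, (T i).X (len i)),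
      IsLocalizedChainOfFundamentalUnits T N len pt tpt ∧ KeySetting (T 0) N ∧ CharHypothesis ((T 0).X 0) (pt 0) ∧
      ∀ i, @IsIsolatedInHSMaxLocus ((T i).X 0) ((T i).ln 0) N (pt i) := by
  have hB : ∀ i, (c (segBaseU hgen hBG i)).IsBlownUp R N ν := Seg.B_segBaseU hgen hBG
  have hG : ∀ i, Iso N (c (segBaseU hgen hBG i)) := Seg.G_segBaseU hgen hBG
  refine ⟨fun i => unitTowerU hc hRa hν h0 hgen hBG (segBaseU hgen hBG i) (hemp _ (hB i) (hG i)), fun i => unitLen hgen hBG (segBaseU hgen hBG i),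
    fun i => basePt hc hRa hν h0 (segBaseU hgen hBG i), fun i => termPtU hc hRa hν h0 hgen hBG (segBaseU hgen hBG i) (hemp _ (hB i) (hG i)),
    ⟨?_, ?_, ?_⟩, ?_, ?_, ?_⟩
  · exact isLocalAt_unitTowerU hc hRa hν h0 hgen hBG (segBaseU hgen hBG 0) _
  · exact fun i => isFundamentalUnit_unitTowerU hc hRf hRa hν h0 hgen hBG hX hreach h22 (segBaseU hgen hBG i) (hB i) (hG i) _ (hdisc _ (hB i) (hG i))
  · exact fun i => isLocalSchemeAt_unitTowerU_terminal hc hRa hν h0 hgen hBG (segBaseU hgen hBG i) _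
  · exact keySetting_unitTowerU hc hRa hν h0 hgen hBG (segBaseU hgen hBG 0) _
  · exact charHypothesis_unitTowerU hc hRa hν h0 hgen hBG (segBaseU hgen hBG 0) _ (hchar _)
  · intro i
    have hcyc : Helpers.CycleInv k N ν (c (segBaseU hgen hBG i)) := cycleInv_at hc hRa hν h0 _
    refine isIsolatedInHSMaxLocus_unitTowerU hc hRa hν h0 hgen hBG (segBaseU hgen hBG i) _
      (fun y hy => hsFun_le_of_specializes_of_cycleInv hcyc hy) ?_
    rw [hsFun_pt hc hX hreach]
    exact stratumIsolated_at hc hRa hν hX hreach _ (hG i)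

include hRf hX hreach in
/-- **(H-emp) WITHIN THE UNIT FROM THE NEAR-LOCUS GEOMETRY** (`…SegmentsHEmp`, p527103): at a blown-up isolated base `b`, the dichotomy
«`N_n` infinite irreducible, or finite closed points» and the regularity of the infinite `N_n` (reduced), for `0 < n <` the relative index of the
next blown-up isolated stage, give `Seg.HEmpU b`. So the recognition row `Seg.UnitRecognitionAtQMU` reduces to these two geometric inputs plus
the centre discipline. [cite: CossartJannsenSaito2020, Def. 6.38 (iii), Lemma 6.33, p. 105] -/
theorem hEmpU_of_nearLocus_geometry (b : ℕ) (hb : (c b).IsBlownUp R N ν) (hiso : Iso N (c b))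
    (hDich : ∀ n, 0 < n → n < Seg.relIdxU hgen hBG b (Seg.relLen hgen hBG b) →
      (((upTower hc hRa hν h0 b).nearLocus N (c b).pt n).Infinite ∧ IsIrreducible ((upTower hc hRa hν h0 b).nearLocus N (c b).pt n)) ∨
      (((upTower hc hRa hν h0 b).nearLocus N (c b).pt n).Finite ∧
        ∀ y ∈ (upTower hc hRa hν h0 b).nearLocus N (c b).pt n, IsClosed ({y} : Set (c (b + n)).W)))
    (hReg : ∀ n, 0 < n → n < Seg.relIdxU hgen hBG b (Seg.relLen hgen hBG b) → ((upTower hc hRa hν h0 b).nearLocus N (c b).pt n).Infinite →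
      ∀ h : IsClosed ((upTower hc hRa hν h0 b).nearLocus N (c b).pt n),
        Scheme.IsRegular (Scheme.IdealSheafData.vanishingIdeal ⟨(upTower hc hRa hν h0 b).nearLocus N (c b).pt n, h⟩).subscheme) :
    HEmpU hc hRa hν h0 hgen hBG b :=
  fun n hn hw => locTower_C_eq_empty_of_lt hc hRf hRa hν h0 hX hreach b hb hiso _ hDich hReg n hn hw

end Extraction

/-! ## §3. The recognition half as one statement, and the extraction for `UnitTowerExtractionLocQM p` -/

/-- [OURS · L1 W4.2] **THE RECOGNITION HALF over an origin predicate `Q`** (stub-2's object): after the binder list of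
`UnitTowerExtractionLocAtQM p Q` and the auxiliary data of the extraction (ground field and cycle invariant at `c 0`, `ν ≠ Φ^{(3)}`, the
blown-up isolated stages), AT EVERY BLOWN-UP ISOLATED STAGE `b`: (H-emp) `Seg.HEmp … b` (waiting steps have empty localised centres) and the
CENTRE DISCIPLINE `Seg.UnitCentreDiscipline` of the unit tower `Seg.unitTower … b` (CJS Def. 6.38 (ii)′ `C_1 = ℙ(Dir)`, (iii) `C_q` = near
locus, (iv) `C_q ⥲ C_{q−1}`, (v) non-surjectivity — Thm. 3.14 / Lemma 6.33 territory). All proof arguments are irrelevant (any choice will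
do). [cite: CossartJannsenSaito2020, Def. 6.38, Thm. 3.14] -/
def UnitRecognitionAtQMU (p : ℕ) (Q : ℕ → (ℕ → ℕ) → ∀ X : Scheme.{0}, X → Prop) : Prop :=
  ∀ (R : ∀ S : Scheme.{0}, CentreSeq S → Prop) (_ : OracleFunctional R) (hRa : OracleAdmissible R)
    (ν : ℕ → ℕ) (X : Scheme.{0}) [IsLocallyNoetherian X] (x : X), IsMaximalOrigin p 3 ν X x → Q 3 ν X x →
  ∀ (c : ℕ → MarkedStage.{0}), Reaches R 3 ν (MarkedStage.init X x) (c 0) →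
    ∀ (hc : ∀ n, CanonicalNearStep R 3 ν (c n) (c (n + 1))), (∀ n, (c n).geomDirDim ≤ 2) →
    ∀ (hgen : ∀ n, ∃ m, n ≤ m ∧ (c m).IsBlownUp R 3 ν), (∀ n, ∃ m, n ≤ m ∧ Iso 3 (c m)) →
    (∀ n, Iso 3 (c n) → dirDim (c n) = 2 ∧ (c n).geomDirDim = 2) →
    ∀ (k : Type) (_ : Field k) (h0 : Helpers.CycleInv k 3 ν (c 0)) (hν : ν ≠ iterPSum 3 Phi)
      (hBG : ∀ n, ∃ m, n ≤ m ∧ (c m).IsBlownUp R 3 ν ∧ Iso 3 (c m)) (b : ℕ),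
      (c b).IsBlownUp R 3 ν → Iso 3 (c b) →
        ∃ he : Seg.HEmpU hc hRa hν h0 hgen hBG b,
          Seg.UnitCentreDiscipline (Seg.unitTowerU hc hRa hν h0 hgen hBG b he) 3 (Seg.unitLen hgen hBG b) (Seg.basePt hc hRa hν h0 b)

end Seg

/-- **THE UNITS-HALF EXTRACTION IN THE (F1) REGIME, MODULO RECOGNITION**: `Seg.UnitRecognitionAtQM p (QCharRegime p) → UnitTowerExtractionLocQM p`
— the case `ν = Φ^{(3)}` is vacuous (no genuine step from a maximal origin of the regular value, `…RegularValue`), the cut stages exist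
(`…SegmentsIso`), (F1) holds along the chain (`…WLadderCharHypothesis`), and `Seg.exists_localizedChain` assembles the rest.
[cite: CossartJannsenSaito2020, Def. 6.38, Def. 6.39, Thm. 6.40, p. 107] -/
theorem unitTowerExtractionLocQM_of_recognitionU (p : ℕ) (hrec : Seg.UnitRecognitionAtQMU p (QCharRegime p)) :
    UnitTowerExtractionLocQM p := by
  intro R hRf hRa ν X _ x hX hq c hreach hc hē hgen hIso h22
  -- `ν ≠ Φ^{(3)}`: otherwise no stage reached from the origin is blown up
  have hν : ν ≠ iterPSum 3 Phi := by
    intro hν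
    obtain ⟨m, -, hm⟩ := hgen 0
    exact hX.not_isBlownUp_of_eq_iterPSum hRf hRa hν (reaches_chain hreach hc m) (hc m) hm
  obtain ⟨k, _, hcyc⟩ := Helpers.CycleInv.init (N := 3) (ν := ν) hX
  have h0 : Helpers.CycleInv k 3 ν (c 0) := hcyc.of_reaches hRa hν hreach
  have hBG := Seg.exists_isBlownUp_and_iso hRa hν hX hreach hc hgen hIso
  have hrec' := hrec R hRf hRa ν X x hX hq c hreach hc hē hgen hIso h22 k inferInstance h0 hν hBG
  exact Seg.exists_localizedChainU hc hRf hRa hν h0 hgen hBG hX hreach h22 (fun b hb hiso => (hrec' b hb hiso).choose)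
    (fun b hb hiso => (hrec' b hb hiso).choose_spec) (fun n => charHypothesis_of_chain hX hq hreach hc n (c n).pt)

namespace Seg

section Extraction

variable {R : ∀ S : Scheme.{0}, CentreSeq S → Prop} {N : ℕ} {ν : ℕ → ℕ} {k : Type} [Field k]
  {c : ℕ → MarkedStage.{0}} (hc : ∀ n, CanonicalNearStep R N ν (c n) (c (n + 1))) (hRf : OracleFunctional R) (hRa : OracleAdmissible R)
  (hν : ν ≠ iterPSum N Phi) (h0 : Helpers.CycleInv k N ν (c 0)) (hgen : ∀ n, ∃ m, n ≤ m ∧ (c m).IsBlownUp R N ν)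
  (hBG : ∀ n, ∃ m, n ≤ m ∧ (c m).IsBlownUp R N ν ∧ Iso N (c m))
  {p : ℕ} {X : Scheme.{0}} [IsLocallyNoetherian X] {x : X} (hX : IsMaximalOrigin p N ν X x)
  (hreach : Reaches R N ν (MarkedStage.init X x) (c 0)) (h22 : ∀ n, Iso N (c n) → dirDim (c n) = 2 ∧ (c n).geomDirDim = 2)

include hRf hX hreach h22 in
/-- **THE UNITS-HALF EXTRACTION WITHOUT (F1)**: as `Seg.exists_localizedChain`, with the `CharHypothesis` hypothesis and conjunct dropped.
[cite: CossartJannsenSaito2020, Def. 6.38, Def. 6.39, p. 107] -/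
theorem exists_localizedChainU_free
    (hemp : ∀ b, (c b).IsBlownUp R N ν → Iso N (c b) → HEmpU hc hRa hν h0 hgen hBG b)
    (hdisc : ∀ b (hb : (c b).IsBlownUp R N ν) (hiso : Iso N (c b)),
      UnitCentreDiscipline (unitTowerU hc hRa hν h0 hgen hBG b (hemp b hb hiso)) N (unitLen hgen hBG b) (basePt hc hRa hν h0 b)) :
    ∃ (T : ℕ → BlowupTower.{0}) (len : ℕ → ℕ) (pt : ∀ i, (T i).X 0) (tpt : ∀ i, (T i).X (len i)),
      IsLocalizedChainOfFundamentalUnits T N len pt tpt ∧ KeySetting (T 0) N ∧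
      ∀ i, @IsIsolatedInHSMaxLocus ((T i).X 0) ((T i).ln 0) N (pt i) := by
  have hB : ∀ i, (c (segBaseU hgen hBG i)).IsBlownUp R N ν := Seg.B_segBaseU hgen hBG
  have hG : ∀ i, Iso N (c (segBaseU hgen hBG i)) := Seg.G_segBaseU hgen hBG
  refine ⟨fun i => unitTowerU hc hRa hν h0 hgen hBG (segBaseU hgen hBG i) (hemp _ (hB i) (hG i)), fun i => unitLen hgen hBG (segBaseU hgen hBG i),
    fun i => basePt hc hRa hν h0 (segBaseU hgen hBG i), fun i => termPtU hc hRa hν h0 hgen hBG (segBaseU hgen hBG i) (hemp _ (hB i) (hG i)),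
    ⟨?_, ?_, ?_⟩, ?_, ?_⟩
  · exact isLocalAt_unitTowerU hc hRa hν h0 hgen hBG (segBaseU hgen hBG 0) _
  · exact fun i => isFundamentalUnit_unitTowerU hc hRf hRa hν h0 hgen hBG hX hreach h22 (segBaseU hgen hBG i) (hB i) (hG i) _ (hdisc _ (hB i) (hG i))
  · exact fun i => isLocalSchemeAt_unitTowerU_terminal hc hRa hν h0 hgen hBG (segBaseU hgen hBG i) _
  · exact keySetting_unitTowerU hc hRa hν h0 hgen hBG (segBaseU hgen hBG 0) _
  · intro i
    have hcyc : Helpers.CycleInv k N ν (c (segBaseU hgen hBG i)) := cycleInv_at hc hRa hν h0 _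
    refine isIsolatedInHSMaxLocus_unitTowerU hc hRa hν h0 hgen hBG (segBaseU hgen hBG i) _
      (fun y hy => hsFun_le_of_specializes_of_cycleInv hcyc hy) ?_
    rw [hsFun_pt hc hX hreach]
    exact stratumIsolated_at hc hRa hν hX hreach _ (hG i)

end Extraction

end Seg

/-- **THE UNITS-HALF EXTRACTION OVER ANY ORIGIN PREDICATE `Q`, CHARACTERISTIC-FREE, MODULO RECOGNITION** — the binders of
`UnitTowerExtractionLocAtQM p Q`, conclusion without `CharHypothesis` (for the `p = 2`, `dim X = 3` row, to be met by a characteristic-free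
unit-wise localised Thm. 6.40). [cite: CossartJannsenSaito2020, Def. 6.38, Def. 6.39, Thm. 6.40, p. 107] -/
theorem unitTowerExtractionLocFree_of_recognitionU (p : ℕ) (Q : ℕ → (ℕ → ℕ) → ∀ X : Scheme.{0}, X → Prop)
    (hrec : Seg.UnitRecognitionAtQMU p Q) :
    ∀ (R : ∀ S : Scheme.{0}, CentreSeq S → Prop), OracleFunctional R → OracleAdmissible R →
    ∀ (ν : ℕ → ℕ) (X : Scheme.{0}) [IsLocallyNoetherian X] (x : X), IsMaximalOrigin p 3 ν X x → Q 3 ν X x →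
    ∀ c : ℕ → MarkedStage.{0}, Reaches R 3 ν (MarkedStage.init X x) (c 0) →
      (∀ n, CanonicalNearStep R 3 ν (c n) (c (n + 1))) → (∀ n, (c n).geomDirDim ≤ 2) →
      (∀ n, ∃ m, n ≤ m ∧ (c m).IsBlownUp R 3 ν) → (∀ n, ∃ m, n ≤ m ∧ Iso 3 (c m)) →
      (∀ n, Iso 3 (c n) → dirDim (c n) = 2 ∧ (c n).geomDirDim = 2) →
      ∃ (T : ℕ → BlowupTower.{0}) (len : ℕ → ℕ) (pt : ∀ i, (T i).X 0) (tpt : ∀ i, (T i).X (len i)),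
        IsLocalizedChainOfFundamentalUnits T 3 len pt tpt ∧ KeySetting (T 0) 3 ∧
        ∀ i, @IsIsolatedInHSMaxLocus ((T i).X 0) ((T i).ln 0) 3 (pt i) := by
  intro R hRf hRa ν X _ x hX hq c hreach hc hē hgen hIso h22
  have hν : ν ≠ iterPSum 3 Phi := by
    intro hν
    obtain ⟨m, -, hm⟩ := hgen 0
    exact hX.not_isBlownUp_of_eq_iterPSum hRf hRa hν (reaches_chain hreach hc m) (hc m) hm
  obtain ⟨k, _, hcyc⟩ := Helpers.CycleInv.init (N := 3) (ν := ν) hX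
  have h0 : Helpers.CycleInv k 3 ν (c 0) := hcyc.of_reaches hRa hν hreach
  have hBG := Seg.exists_isBlownUp_and_iso hRa hν hX hreach hc hgen hIso
  have hrec' := hrec R hRf hRa ν X x hX hq c hreach hc hē hgen hIso h22 k inferInstance h0 hν hBG
  exact Seg.exists_localizedChainU_free hc hRf hRa hν h0 hgen hBG hX hreach h22 (fun b hb hiso => (hrec' b hb hiso).choose)
    fun b hb hiso => (hrec' b hb hiso).choose_spec

/-- The (F1)-form recovered: over `Q` with (F1) ALONG the chain at the bases (e.g. `QCharRegime p`), the characteristic-free extraction plus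
`CharHypothesis` at the first base give `UnitTowerExtractionLocAtQM p Q` — so ONE recognition statement serves every origin predicate.
[cite: CossartJannsenSaito2020, Thm. 10.2, Def. 6.39] -/
theorem unitTowerExtractionLocAtQM_of_recognitionU (p : ℕ) (Q : ℕ → (ℕ → ℕ) → ∀ X : Scheme.{0}, X → Prop)
    (hQ : ∀ (R : ∀ S : Scheme.{0}, CentreSeq S → Prop) (ν : ℕ → ℕ) (X : Scheme.{0}) [IsLocallyNoetherian X] (x : X),
      IsMaximalOrigin p 3 ν X x → Q 3 ν X x → ∀ s : MarkedStage.{0}, Reaches R 3 ν (MarkedStage.init X x) s → CharHypothesis s.W s.pt)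
    (hrec : Seg.UnitRecognitionAtQMU p Q) : UnitTowerExtractionLocAtQM p Q := by
  intro R hRf hRa ν X _ x hX hq c hreach hc hē hgen hIso h22
  have hν : ν ≠ iterPSum 3 Phi := by
    intro hν
    obtain ⟨m, -, hm⟩ := hgen 0
    exact hX.not_isBlownUp_of_eq_iterPSum hRf hRa hν (reaches_chain hreach hc m) (hc m) hm
  obtain ⟨k, _, hcyc⟩ := Helpers.CycleInv.init (N := 3) (ν := ν) hX
  have h0 : Helpers.CycleInv k 3 ν (c 0) := hcyc.of_reaches hRa hν hreach
  have hBG := Seg.exists_isBlownUp_and_iso hRa hν hX hreach hc hgen hIso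
  have hrec' := hrec R hRf hRa ν X x hX hq c hreach hc hē hgen hIso h22 k inferInstance h0 hν hBG
  exact Seg.exists_localizedChainU hc hRf hRa hν h0 hgen hBG hX hreach h22 (fun b hb hiso => (hrec' b hb hiso).choose)
    (fun b hb hiso => (hrec' b hb hiso).choose_spec) (fun n => hQ R ν X x hX hq (c n) (reaches_chain hreach hc n))

end Summit.ResolutionOfSingularities.ResolutionOfSingularities.Theorems.SigmaMaxModificationsCorridor3.Moving

end
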